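import Literature.Computability.Complexity.MurrayWilliams2018HeadlineQP
import Literature.Computability.Complexity.MurrayWilliams2018SimulationProofsQ
import HarnessLib

/-!
# Murray–Williams' headline `NQP ⊄ ACC⁰` from Theorem 3.1 ALONE

Leaf module joining `MurrayWilliams2018HeadlineQP.lean` (the headline
`MurrayWilliams2018_NQP_not_subset_ACC0 : ¬ (NQP ⊆ ACC0)`, `CircuitLowerBounds.lean`; C. D. Murray,
R. R. Williams, *Circuit lower bounds for nondeterministic quasi-polytime: an easy witness lemma for
NP and NQP*, STOC 2018, §1.1 and Thm. 1.3 — from Theorem 3.1 in universal-referee form `h31` and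
the polylogarithmic-seed advice simulation `hsimQ`,
`MurrayWilliams2018_NQP_not_subset_ACC0_of_thm_3_1_universal_of_qsimulation`) with
`MurrayWilliams2018SimulationProofsQ.lean`, where `hsimQ` is PROVED (`MWSimQN.hsimQ_of_thm11`: the
derandomised advice simulation of the printed proof of Lemma 4.1 run with the tree's proved
generator `IKW2002_thm11_tableGenerator` in place of Umans' Thm. 2.1):

* **`MurrayWilliams2018_NQP_not_subset_ACC0_of_thm_3_1_universal`** — `¬ (NQP ⊆ ACC0)` from the
  single remaining hypothesis `h31`: Murray–Williams' Theorem 3.1 (the "almost" almost-everywhere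
  circuit lower bound for Merlin–Arthur protocols with advice) in universal-referee form with
  general `s₁, s₂` (the hypothesis of `h31_of_thm_3_1_universal`,
  `MurrayWilliams2018EasyWitnessAssembly.lean`); and the same for Lemma 1.3 at the tree's levels
  (`MurrayWilliams2018_lemma_1_3_of_thm_3_1_universal`), the common input of the headline and of
  Thm. 1.2 / Thm. 1.3 (`MurrayWilliams2018_thm_1_2_acc_of_thm_3_1_universal_of_expSimulation`,
  `MurrayWilliams2018SimulationProofsQ.lean`, which needs in addition the exponential-level
  simulation `hN`).

After this file the trust base of the headline is {Theorem 3.1 of the source}: its hardness half is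
the theorem `AlmostAE.eventually_lt_circuitSize_or` (`MurrayWilliams2018AlmostAE.lean`); its upper
bound — the Merlin–Arthur protocol with advice over a paddable, downward self-reducible,
same-length-checkable complete language (Santhanam 2007 / Trevisan–Vadhan 2002) — is what remains.
Theorems only; no definition and no named fact is introduced.

## References

* C. D. Murray, R. R. Williams, *Circuit lower bounds for nondeterministic quasi-polytime: an easy
  witness lemma for NP and NQP*, STOC 2018, 890–901, §1.1, Lemma 1.3, Thm. 1.3, Thm. 3.1, Lemma 4.1
  and its proof (§4), §5 [MurrayWilliams2018].
* R. Impagliazzo, V. Kabanets, A. Wigderson, *In search of an easy witness: exponential time vs.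
  probabilistic polynomial time*, JCSS 65 (2002) 672–694, Thm. 11 [ImpagliazzoKabanetsWigderson2002].
-/

namespace Literature.Computability.Complexity

open Filter AMPlayer

/-- **`NQP ⊄ ACC⁰` from Murray–Williams' Theorem 3.1 alone** (universal-referee form, general
`s₁, s₂`): the polylogarithmic-seed simulation is the theorem `MWSimQN.hsimQ_of_thm11`.
[cite: MurrayWilliams2018, §1.1, Thm. 1.3 and Thm. 3.1] -/
theorem MurrayWilliams2018_NQP_not_subset_ACC0_of_thm_3_1_universal
    (h31 : ∃ Ref : Language Bool, Ref ∈ Classes.P ∧ ∃ D : ℕ, 1 ≤ D ∧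
      ∀ (s s₁ s₂ : ℕ → ℕ), StrictMono s → IsTimeConstructible s →
        (∀ᶠ n in atTop, n * s n ^ 2 < 2 ^ n) →
        IsTimeConstructible s₁ → IsTimeConstructible s₂ →
        (∀ᶠ n in atTop, (n + s n + 2) ^ D ≤ s₂ n) → (∀ᶠ n in atTop, s (s₂ n) ^ D ≤ s₁ n) →
        (∀ᶠ n in atTop, (n + s n + 2) ^ D ≤ s₁ n) →
        ∃ (adv : ℕ → List Bool) (L₁ : Language Bool),
          (∀ n, (adv n).length ≤ D * (Nat.log 2 (s₂ n) + 1)) ∧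
          AdvisedMAGame Ref (fun n => (s₁ n * s₂ n) ^ D) adv L₁ ∧
          ∀ᶠ n in atTop, s n < L₁.circuitSize n ∨ s (s₂ n) < L₁.circuitSize (s₂ n)) :
    MurrayWilliams2018_NQP_not_subset_ACC0 :=
  MurrayWilliams2018_NQP_not_subset_ACC0_of_thm_3_1_universal_of_qsimulation h31 fun Ref hRef =>
    MWSimQN.hsimQ_of_thm11 Ref hRef

/-- **Murray–Williams' easy witness lemma for `NQP` (Lemma 1.3, at the tree's levels) from
Theorem 3.1 alone** — hypothesis `hEWL` of the §5 assemblies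
(`MurrayWilliams2018_thm_1_2_acc_of_EWL_of_expSimulation`, `…_of_EWL_of_expSimulationAllDepths`,
`MurrayWilliams2018_NQP_not_subset_ACC0_of_EWL`), by `MurrayWilliams2018_lemma_1_3_of_lemma_4_1_qp`
on `MurrayWilliams2018_lemma_4_1_qp_of_thm_3_1_universal`. [cite: MurrayWilliams2018, Lemma 1.3 and Thm. 3.1] -/
theorem MurrayWilliams2018_lemma_1_3_of_thm_3_1_universal
    (h31 : ∃ Ref : Language Bool, Ref ∈ Classes.P ∧ ∃ D : ℕ, 1 ≤ D ∧
      ∀ (s s₁ s₂ : ℕ → ℕ), StrictMono s → IsTimeConstructible s →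
        (∀ᶠ n in atTop, n * s n ^ 2 < 2 ^ n) →
        IsTimeConstructible s₁ → IsTimeConstructible s₂ →
        (∀ᶠ n in atTop, (n + s n + 2) ^ D ≤ s₂ n) → (∀ᶠ n in atTop, s (s₂ n) ^ D ≤ s₁ n) →
        (∀ᶠ n in atTop, (n + s n + 2) ^ D ≤ s₁ n) →
        ∃ (adv : ℕ → List Bool) (L₁ : Language Bool),
          (∀ n, (adv n).length ≤ D * (Nat.log 2 (s₂ n) + 1)) ∧
          AdvisedMAGame Ref (fun n => (s₁ n * s₂ n) ^ D) adv L₁ ∧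
          ∀ᶠ n in atTop, s n < L₁.circuitSize n ∨ s (s₂ n) < L₁.circuitSize (s₂ n)) :
    ∀ k : ℕ, 1 ≤ k →
      (∀ e : ℕ, 1 ≤ e → ∀ L ∈ NTIME (fun n => n ^ Nat.log 2 n ^ e),
          ∀ᶠ n in atTop, L.circuitSize n ≤ 2 ^ Nat.log 2 n ^ k) →
        ∃ K e₀ : ℕ, 1 ≤ K ∧ ∀ e : ℕ, e₀ ≤ e →
          NTIMEHasWitnessCircuits (fun n => n ^ Nat.log 2 n ^ e) (fun n => 2 ^ Nat.log 2 n ^ K) :=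
  MurrayWilliams2018_lemma_1_3_of_lemma_4_1_qp (MurrayWilliams2018_lemma_4_1_qp_of_thm_3_1_universal h31)

end Literature.Computability.Complexity
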